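import Literature.InformationTheory.QuantumCodes.ThresholdTheorems
import Mathlib.Logic.Equiv.Fin.Basic
import Mathlib.Algebra.BigOperators.Pi
import Mathlib.Data.Finset.Powerset
import HarnessLib

/-!
# The badness recursion of a self-similar hierarchy from INDEPENDENCE: `ε⁽ᵏ⁾ ≤ A (ε⁽ᵏ⁻¹⁾)²` and Lemma 2 of
# Aliferis–Gottesman–Preskill, proved for nonoverlapping blocks (the code-capacity concatenation model)

Topic `Literature/InformationTheory/QuantumCodes` (continues `ThresholdTheorems.lean`). There the quantitative skeleton of the
threshold theorem for concatenated distance-3 codes takes the recursion `x (k+1) ≤ ε₀⁻¹ (x k)²` as a HYPOTHESIS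
(`AGP06.le_levelBound_of_sq_recursion`). Aliferis–Gottesman–Preskill (2006, §3.1) obtain that recursion from the probabilistic
model: faults occur independently with probability `ε` at each location; a level-`(k+1)` structure is *bad* iff it contains two
independent bad level-`k` substructures, "and because independent bad `(k-1)`-exRecs are independent events, the probability
`ε⁽ᵏ⁾` that a `k`-exRec is bad satisfies `ε⁽ᵏ⁾ ≤ A (ε⁽ᵏ⁻¹⁾)²`" (eq. (pbad-recursion)), whence Lemma 2: `ε⁽ᵏ⁾ ≤ ε₀ (ε/ε₀)^{2^k}` with
`ε₀⁻¹ = A` the number of pairs of locations. This file PROVES that step for the self-similar hierarchy with NONOVERLAPPING blocks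
(`n` locations per block, `k` levels, the `n^k` elementary locations indexed by words `Fin k → Fin n`; this is exactly the model of a
level-`k` concatenated `t = 1` code under independent noise with hierarchical (level-by-level) decoding, where a block is
mis-decoded only if at least two of its sub-blocks are):

* `IsBad n k x` — the recursive badness predicate on fault patterns `x : (Fin k → Fin n) → Bool` (level `0`: the location is faulty;
  level `k+1`: two distinct bad sub-blocks);
* `wt p k x = ∏_v (x v ? p : 1 - p)` — the independent (Bernoulli-`p`) weight, `badProb p n k = Σ_{x bad} wt p k x`;
* `wt_succ` (the weight factorises over the `n` sub-blocks), `sum_wt` (total mass `1`), `badProb_zero` (`= p`);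
* **`badProb_succ_le`** — `badProb p n (k+1) ≤ (n choose 2) · (badProb p n k)²` (union bound over the pairs of sub-blocks, then
  independence of disjoint sub-blocks: eq. (pbad-recursion) PROVED);
* **`badProb_le_levelBound`** — `badProb p n k ≤ ε₀ (p/ε₀)^{2^k}` with `ε₀ = (n choose 2)⁻¹` (Lemma 2, via the tree's skeleton), and
  `badProb_le_of_le_threshold` (`p ≤ ε₀ ⇒ badProb ≤ ε₀ (p/ε₀)^{2^k} ≤ ε₀`: double-exponential decay below `ε₀`).

Not modelled here (and not needed for the code-capacity statement): OVERLAPPING extended rectangles (AGP §3.1's "independent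
pairs" of bad exRecs sharing an error-correction step) and the malignant-pair refinement of their Theorem 2.

## References

* [AliferisGottesmanPreskill2006] P. Aliferis, D. Gottesman, J. Preskill, *Quantum accuracy threshold for concatenated distance-3
  codes*, Quantum Inf. Comput. 6 (2006) 97–165, §3.1 (definition of badness; eqs. (level1-pfail), (pbad-recursion); Lemma 2).
-/

noncomputable section

open Finset
open scoped BigOperators

namespace Literature.InformationTheory.QuantumCodes

namespace AGP06

variable {n : ℕ}

/-! ### The hierarchy: fault patterns on words, sub-blocks -/

/-- The fault pattern of the `i`-th sub-block of a level-`(k+1)` pattern (the locations whose word starts with `i`).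
[cite: AliferisGottesmanPreskill2006, §3.1 (the self-similarity of the k-exRecs)] -/
def subBlock {k : ℕ} (x : (Fin (k + 1) → Fin n) → Bool) (i : Fin n) : (Fin k → Fin n) → Bool :=
  fun v => x (Fin.cons i v)

/-- **Badness** (nonoverlapping model): a level-`0` structure (one location) is bad iff it is faulty; a level-`(k+1)` structure is
bad iff it contains two distinct bad level-`k` sub-blocks. [cite: AliferisGottesmanPreskill2006, §3.1 (Definition: Goodness and Badness)] -/
def IsBad (n : ℕ) : (k : ℕ) → ((Fin k → Fin n) → Bool) → Prop
  | 0, x => x default = true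
  | k + 1, x => ∃ i j : Fin n, i ≠ j ∧ IsBad n k (subBlock x i) ∧ IsBad n k (subBlock x j)

/-- Badness is decidable (a finite Boolean condition). [cite: AliferisGottesmanPreskill2006, §3.1] -/
instance instDecidableIsBad (n : ℕ) : (k : ℕ) → (x : (Fin k → Fin n) → Bool) → Decidable (IsBad n k x)
  | 0, x => by unfold IsBad; infer_instance
  | k + 1, x => by
    unfold IsBad
    haveI : ∀ y, Decidable (IsBad n k y) := instDecidableIsBad n k
    infer_instance

/-! ### The independent weight -/

/-- The weight of a fault pattern under independent faults of rate `p`: `∏_v (p if v is faulty, 1 - p otherwise)`.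
[cite: AliferisGottesmanPreskill2006, §3.1 ("stochastic faults occur independently, with probability ε, at each circuit location")] -/
def wt (p : ℝ) (k : ℕ) (x : (Fin k → Fin n) → Bool) : ℝ :=
  ∏ v : Fin k → Fin n, (if x v then p else 1 - p)

/-- The probability that a level-`k` structure is bad: `ε⁽ᵏ⁾ = Σ_{x bad} wt p k x`.
[cite: AliferisGottesmanPreskill2006, §3.1 (ε^{(k)})] -/
def badProb (p : ℝ) (n k : ℕ) : ℝ :=
  ∑ x : (Fin k → Fin n) → Bool, if IsBad n k x then wt p k x else 0

/-- The weight is non-negative for `0 ≤ p ≤ 1`. [cite: AliferisGottesmanPreskill2006, §3.1] -/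
theorem wt_nonneg {p : ℝ} (hp0 : 0 ≤ p) (hp1 : p ≤ 1) (k : ℕ) (x : (Fin k → Fin n) → Bool) : 0 ≤ wt p k x := by
  unfold wt
  refine Finset.prod_nonneg fun v _ => ?_
  split_ifs
  · exact hp0
  · linarith

/-- The badness probability is non-negative for `0 ≤ p ≤ 1`. [cite: AliferisGottesmanPreskill2006, §3.1] -/
theorem badProb_nonneg {p : ℝ} (hp0 : 0 ≤ p) (hp1 : p ≤ 1) (n k : ℕ) : 0 ≤ badProb p n k := by
  unfold badProb
  refine Finset.sum_nonneg fun x _ => ?_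
  split_ifs
  · exact wt_nonneg hp0 hp1 k x
  · exact le_rfl

/-- The bijection "level-`(k+1)` pattern ↦ its `n` sub-block patterns". [cite: AliferisGottesmanPreskill2006, §3.1 (self-similarity)] -/
def subBlockEquiv (n k : ℕ) : ((Fin (k + 1) → Fin n) → Bool) ≃ (Fin n → (Fin k → Fin n) → Bool) where
  toFun x := subBlock x
  invFun y := fun w => y (w 0) (Fin.tail w)
  left_inv x := by
    funext w
    simp only [subBlock]
    rw [Fin.cons_self_tail]
  right_inv y := by
    funext i v
    simp only [subBlock, Fin.cons_zero, Fin.tail_cons]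

/-- **The weight factorises over the sub-blocks**: `wt p (k+1) x = ∏_i wt p k (subBlock x i)` (disjoint sub-blocks carry
independent faults). [cite: AliferisGottesmanPreskill2006, §3.1 (independent faults)] -/
theorem wt_succ (p : ℝ) (k : ℕ) (x : (Fin (k + 1) → Fin n) → Bool) :
    wt p (k + 1) x = ∏ i : Fin n, wt p k (subBlock x i) := by
  unfold wt subBlock
  rw [← Fintype.prod_prod_type' (f := fun (i : Fin n) (v : Fin k → Fin n) => if x (Fin.cons i v) then p else 1 - p)]
  exact (Fintype.prod_equiv (Fin.consEquiv fun _ => Fin n)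
    (fun q => if x (Fin.cons q.1 q.2) then p else 1 - p) _ (fun q => rfl)).symm

/-- At level `0` the weight of a pattern is `p` or `1 - p` according to its single location. [cite: AliferisGottesmanPreskill2006, §3.1] -/
theorem wt_zero (p : ℝ) (x : (Fin 0 → Fin n) → Bool) : wt p 0 x = if x default then p else 1 - p := by
  unfold wt
  rw [Fintype.prod_unique]

/-- The total weight is `1` (a probability distribution). [cite: AliferisGottesmanPreskill2006, §3.1] -/
theorem sum_wt (p : ℝ) (n : ℕ) : ∀ k : ℕ, ∑ x : (Fin k → Fin n) → Bool, wt p k x = 1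
  | 0 => by
    -- one location: the two patterns `faulty` / `not faulty`
    simp_rw [wt_zero]
    rw [← (Equiv.funUnique (Fin 0 → Fin n) Bool).symm.sum_comp]
    simp [Equiv.funUnique]
  | k + 1 => by
    have ih := sum_wt p n k
    calc ∑ x : (Fin (k + 1) → Fin n) → Bool, wt p (k + 1) x
        = ∑ x : (Fin (k + 1) → Fin n) → Bool, ∏ i : Fin n, wt p k (subBlockEquiv n k x i) := by
          refine Finset.sum_congr rfl fun x _ => ?_
          rw [wt_succ]; rfl
      _ = ∑ y : Fin n → (Fin k → Fin n) → Bool, ∏ i : Fin n, wt p k (y i) :=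
          Fintype.sum_equiv (subBlockEquiv n k) _ _ fun x => rfl
      _ = ∏ i : Fin n, ∑ z : (Fin k → Fin n) → Bool, wt p k z := by
          rw [Finset.prod_univ_sum]
          simp only [Fintype.piFinset_univ]
      _ = 1 := by rw [ih]; simp

/-- At level `0` the badness probability is the physical rate: `ε⁽⁰⁾ = p`. [cite: AliferisGottesmanPreskill2006, §3.1 eq. (level1-pfail)] -/
theorem badProb_zero (p : ℝ) (n : ℕ) : badProb p n 0 = p := by
  unfold badProb
  simp_rw [wt_zero]
  rw [← (Equiv.funUnique (Fin 0 → Fin n) Bool).symm.sum_comp]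
  simp [Equiv.funUnique, IsBad]

/-! ### The recursion from independence -/

/-- A bad level-`(k+1)` pattern has a PAIR (a `2`-subset) of bad sub-blocks. [cite: AliferisGottesmanPreskill2006, §3.1] -/
theorem exists_pair_of_isBad {k : ℕ} {x : (Fin (k + 1) → Fin n) → Bool} (h : IsBad n (k + 1) x) :
    ∃ s ∈ (Finset.univ : Finset (Fin n)).powersetCard 2, ∀ i ∈ s, IsBad n k (subBlock x i) := by
  obtain ⟨i, j, hij, hi, hj⟩ := h
  refine ⟨{i, j}, ?_, ?_⟩
  · rw [Finset.mem_powersetCard]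
    exact ⟨Finset.subset_univ _, Finset.card_pair hij⟩
  · intro l hl
    rw [Finset.mem_insert, Finset.mem_singleton] at hl
    rcases hl with rfl | rfl
    · exact hi
    · exact hj

/-- Independence of disjoint sub-blocks: the weight of "every sub-block in `s` is bad" is `(ε⁽ᵏ⁾)^{|s|}`.
[cite: AliferisGottesmanPreskill2006, §3.1 ("independent bad (k-1)-exRecs are independent events")] -/
theorem sum_wt_all_bad (p : ℝ) (k : ℕ) (s : Finset (Fin n)) :
    ∑ y : Fin n → (Fin k → Fin n) → Bool, (if ∀ i ∈ s, IsBad n k (y i) then ∏ i : Fin n, wt p k (y i) else 0) =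
      badProb p n k ^ s.card := by
  classical
  -- write the indicator-weighted product as a product of per-block factors
  have hterm : ∀ y : Fin n → (Fin k → Fin n) → Bool,
      (if ∀ i ∈ s, IsBad n k (y i) then ∏ i : Fin n, wt p k (y i) else 0) =
        ∏ i : Fin n, (if i ∈ s then (if IsBad n k (y i) then wt p k (y i) else 0) else wt p k (y i)) := by
    intro y
    by_cases hall : ∀ i ∈ s, IsBad n k (y i)
    · rw [if_pos hall]
      refine Finset.prod_congr rfl fun i _ => ?_
      by_cases hi : i ∈ s
      · rw [if_pos hi, if_pos (hall i hi)]
      · rw [if_neg hi]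
    · rw [if_neg hall]
      simp only [not_forall] at hall
      obtain ⟨i, hi, hbad⟩ := hall
      symm
      exact Finset.prod_eq_zero (Finset.mem_univ i) (by rw [if_pos hi, if_neg hbad])
  simp_rw [hterm]
  have key : ∑ y : Fin n → (Fin k → Fin n) → Bool,
      ∏ i : Fin n, (if i ∈ s then (if IsBad n k (y i) then wt p k (y i) else 0) else wt p k (y i)) =
        ∏ i : Fin n, ∑ z : (Fin k → Fin n) → Bool,
          (if i ∈ s then (if IsBad n k z then wt p k z else 0) else wt p k z) := by
    rw [Finset.prod_univ_sum]
    simp only [Fintype.piFinset_univ]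
  rw [key]
  -- per-block sums: `badProb` on `s`, `1` off `s`
  have hfac : ∀ i : Fin n, (∑ z : (Fin k → Fin n) → Bool,
      (if i ∈ s then (if IsBad n k z then wt p k z else 0) else wt p k z)) =
        if i ∈ s then badProb p n k else 1 := by
    intro i
    by_cases hi : i ∈ s
    · simp only [if_pos hi]; rfl
    · simp only [if_neg hi]; exact sum_wt p n k
  simp_rw [hfac]
  rw [Finset.prod_ite_mem, Finset.univ_inter, Finset.prod_const]

/-- **The badness recursion `ε⁽ᵏ⁺¹⁾ ≤ (n choose 2) · (ε⁽ᵏ⁾)²`, PROVED from independence** (union bound over the pairs of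
sub-blocks, then the product structure of the weight). [cite: AliferisGottesmanPreskill2006, §3.1 eq. (pbad-recursion)] -/
theorem badProb_succ_le {p : ℝ} (hp0 : 0 ≤ p) (hp1 : p ≤ 1) (n k : ℕ) :
    badProb p n (k + 1) ≤ (n.choose 2 : ℝ) * badProb p n k ^ 2 := by
  classical
  -- pass to sub-block coordinates
  have step1 : badProb p n (k + 1) =
      ∑ y : Fin n → (Fin k → Fin n) → Bool,
        (if ∃ i j : Fin n, i ≠ j ∧ IsBad n k (y i) ∧ IsBad n k (y j) then ∏ i : Fin n, wt p k (y i) else 0) := by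
    unfold badProb
    refine Fintype.sum_equiv (subBlockEquiv n k) _ _ fun x => ?_
    simp only [IsBad, wt_succ]
    rfl
  rw [step1]
  -- union bound over 2-subsets
  have step2 : ∀ y : Fin n → (Fin k → Fin n) → Bool,
      (if ∃ i j : Fin n, i ≠ j ∧ IsBad n k (y i) ∧ IsBad n k (y j) then ∏ i : Fin n, wt p k (y i) else 0) ≤
        ∑ s ∈ (Finset.univ : Finset (Fin n)).powersetCard 2,
          (if ∀ i ∈ s, IsBad n k (y i) then ∏ i : Fin n, wt p k (y i) else 0) := by
    intro y
    have hw : 0 ≤ ∏ i : Fin n, wt p k (y i) := Finset.prod_nonneg fun i _ => wt_nonneg hp0 hp1 k (y i)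
    have hnn : ∀ s ∈ (Finset.univ : Finset (Fin n)).powersetCard 2,
        0 ≤ (if ∀ i ∈ s, IsBad n k (y i) then ∏ i : Fin n, wt p k (y i) else 0) := by
      intro s _; split_ifs <;> [exact hw; exact le_rfl]
    split_ifs with h
    · obtain ⟨i, j, hij, hi, hj⟩ := h
      have hmem : ({i, j} : Finset (Fin n)) ∈ (Finset.univ : Finset (Fin n)).powersetCard 2 := by
        rw [Finset.mem_powersetCard]; exact ⟨Finset.subset_univ _, Finset.card_pair hij⟩
      refine le_trans ?_ (Finset.single_le_sum hnn hmem)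
      have hall : ∀ l ∈ ({i, j} : Finset (Fin n)), IsBad n k (y l) := by
        intro l hl
        rw [Finset.mem_insert, Finset.mem_singleton] at hl
        rcases hl with rfl | rfl
        · exact hi
        · exact hj
      rw [if_pos hall]
    · exact Finset.sum_nonneg hnn
  refine le_trans (Finset.sum_le_sum fun y _ => step2 y) ?_
  rw [Finset.sum_comm]
  -- each pair contributes `(ε⁽ᵏ⁾)²`
  have step3 : ∀ s ∈ (Finset.univ : Finset (Fin n)).powersetCard 2,
      ∑ y : Fin n → (Fin k → Fin n) → Bool,
        (if ∀ i ∈ s, IsBad n k (y i) then ∏ i : Fin n, wt p k (y i) else 0) = badProb p n k ^ 2 := by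
    intro s hs
    rw [sum_wt_all_bad, (Finset.mem_powersetCard.1 hs).2]
  rw [Finset.sum_congr rfl step3, Finset.sum_const, Finset.card_powersetCard, Finset.card_univ, Fintype.card_fin,
    nsmul_eq_mul]

/-- **Lemma 2 (bad structures are rare), PROVED in the nonoverlapping model**: `ε⁽ᵏ⁾ ≤ ε₀ (p/ε₀)^{2^k}` with
`ε₀ = (n choose 2)⁻¹`, for independent faults of rate `0 ≤ p ≤ 1` (`n ≥ 2` locations per block).
[cite: AliferisGottesmanPreskill2006, Lemma 2] -/
theorem badProb_le_levelBound {p : ℝ} (hp0 : 0 ≤ p) (hp1 : p ≤ 1) (hn : 2 ≤ n) (k : ℕ) :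
    badProb p n k ≤ levelBound ((n.choose 2 : ℝ)⁻¹) p k := by
  have hA : 0 < (n.choose 2 : ℝ) := by
    have : 0 < n.choose 2 := Nat.choose_pos hn
    exact_mod_cast this
  refine le_levelBound_of_sq_recursion (x := fun k => badProb p n k) (inv_pos.2 hA)
    (fun k => badProb_nonneg hp0 hp1 n k) (by rw [badProb_zero]) (fun k => ?_) k
  rw [inv_inv]
  exact badProb_succ_le hp0 hp1 n k

/-- **Below threshold the badness probability decays double-exponentially and never exceeds `ε₀`**:
`p ≤ ε₀ = (n choose 2)⁻¹ ⇒ ε⁽ᵏ⁾ ≤ ε₀ (p/ε₀)^{2^k} ≤ ε₀`. [cite: AliferisGottesmanPreskill2006, Lemma 2 ("for ε < ε₀, the probability of badness declines double-exponentially with k")] -/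
theorem badProb_le_of_le_threshold {p : ℝ} (hp0 : 0 ≤ p) (hn : 2 ≤ n) (hp : p ≤ ((n.choose 2 : ℝ))⁻¹) (k : ℕ) :
    badProb p n k ≤ ((n.choose 2 : ℝ))⁻¹ * (p / ((n.choose 2 : ℝ))⁻¹) ^ 2 ^ k ∧
      badProb p n k ≤ ((n.choose 2 : ℝ))⁻¹ := by
  have hA : 0 < (n.choose 2 : ℝ) := by
    have : 0 < n.choose 2 := Nat.choose_pos hn
    exact_mod_cast this
  have hε₀ : 0 < ((n.choose 2 : ℝ))⁻¹ := inv_pos.2 hA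
  have hp1 : p ≤ 1 := by
    refine hp.trans ?_
    have h1 : (1 : ℝ) ≤ (n.choose 2 : ℝ) := by exact_mod_cast Nat.choose_pos hn
    exact inv_le_one_of_one_le₀ h1
  have h := badProb_le_levelBound hp0 hp1 hn k
  exact ⟨h, h.trans (levelBound_le_self hε₀ hp0 hp k)⟩

/-! ### The smallest distance-3 block: `n = 7` locations, `ε₀ = 1/21` -/

/-- **Blocks of `7` locations** (the block size of Steane's `[[7,1,3]]` code, AGP06 §7): `ε₀ = 1/C(7,2) = 1/21 ≈ .0476`, and for every
`0 ≤ p ≤ 1/21` the level-`k` badness probability is at most `(1/21)·(21 p)^{2^k}` — the code-capacity threshold estimate of the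
concatenated `7`-qubit hierarchy with level-by-level decoding of single faults. [cite: AliferisGottesmanPreskill2006, Lemma 2 and §7 (Steane's [[7,1,3]] code)] -/
theorem badProb_seven_le {p : ℝ} (hp0 : 0 ≤ p) (hp : p ≤ 1 / 21) (k : ℕ) :
    badProb p 7 k ≤ 1 / 21 * (21 * p) ^ 2 ^ k ∧ badProb p 7 k ≤ 1 / 21 := by
  have h21 : ((Nat.choose 7 2 : ℕ) : ℝ) = 21 := by norm_num [Nat.choose]
  have h := badProb_le_of_le_threshold (n := 7) hp0 (by norm_num) (by rw [h21]; simpa using hp) k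
  rw [h21] at h
  refine ⟨?_, by simpa using h.2⟩
  have e : (21 : ℝ)⁻¹ * (p / (21 : ℝ)⁻¹) ^ 2 ^ k = 1 / 21 * (21 * p) ^ 2 ^ k := by
    rw [div_inv_eq_mul, one_div, mul_comm p]
  rw [← e]
  exact h.1

end AGP06

end Literature.InformationTheory.QuantumCodes

end
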